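import Summits.PneNP.PneNP.Theses.KarlinRubin

/-!
# The OR-channel form of `MonotoneSuffices` specialises to the crux

Companion to `Summit.PneNP.PneNP.Theorems.MonotoneSuffices.Negative.monotoneSuffices_false_without_productNoise`
(`Negative/ORChannel.lean`): the statement refuted there — `MonotoneSuffices` with its distribution pair
generalised to an arbitrary "noise `X u` ∨ independent planted pattern `P s`" pair, `u`, `s` independent
uniform samples of finite sets — really IS a generalisation of the crux
`Summit.PneNP.PneNP.Theses.KarlinRubin.MonotoneSuffices`: instantiated at `X = id` on
`EdgeVec n ∼ G(n,1/2)` and `P S =` the edge set of the clique on `S`, `S` uniform in `kSubsets n ⌈n^{1/2-δ}⌉`,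
its two laws are `erdosRenyiHalf n` and `plantedCliqueDist n ⌈n^{1/2-δ}⌉` (`fst_uniform_toOuterMeasure`,
`plant_uniform_toOuterMeasure`), and its size slack `+ |E(Kₙ)|` is absorbed by doubling the exponent
(`(s + C(n,2))^a ≤ (s + n)^{2a}`). Hence `monotoneSufficesAt_iff_orChannel_cliqueInstance`: at every `δ` the crux IS the clique
instance of the OR-channel schema whose block-parity instance is false, so the product noise singled out by
the refutation is a genuine (load-bearing) feature of the crux and not an artefact of the generalised
statement's shape. Everything here is proved.
Refuter seat refuter-cdisprove-stmt-PneNP-18026-0 (cdisprove, cycle 1), 2026-08-17.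
-/

set_option linter.dupNamespace false -- `Summit.PneNP.PneNP.…`: summit = sub-problem name (D-0017 single-conjunct layout)

namespace Summit.PneNP.PneNP.Theorems.MonotoneSuffices.Negative

open Finset Filter Topology
open scoped ENNReal
open Literature.Computability.Complexity Literature.Probability.RandomGraphs.PlantedClique
open Summit.PneNP.PneNP.Theses.KarlinRubin (MonotoneSuffices)

/-- The candidate planted sets form a nonempty finite type (so that the uniform law on them exists).
[folklore] -/
instance instNonemptyKSubsets (n k : ℕ) : Nonempty (kSubsets n k) :=
  ⟨⟨(kSubsets_nonempty n k).choose, (kSubsets_nonempty n k).choose_spec⟩⟩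

/-- Pushforward of a uniform law is counting (membership form). [folklore] -/
theorem uniform_map_toOuterMeasure_mem {Ω' γ : Type*} [Fintype Ω'] [Nonempty Ω'] (g : Ω' → γ)
    (A : Set γ) [DecidablePred (· ∈ A)] :
    ((PMF.uniformOfFintype Ω').map g).toOuterMeasure A =
      ((univ.filter fun ω => g ω ∈ A).card : ℝ≥0∞) / Fintype.card Ω' := by
  classical
  rw [PMF.toOuterMeasure_map_apply,
    show PMF.uniformOfFintype Ω' = PMF.uniformOfFinset univ univ_nonempty from rfl,
    PMF.toOuterMeasure_uniformOfFinset_apply, card_univ]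
  congr 2
  simp only [Set.mem_preimage]

/-- The uniform law itself is counting. [folklore] -/
theorem uniform_toOuterMeasure_eq {γ : Type*} [Fintype γ] [Nonempty γ] (A : Set γ)
    [DecidablePred (· ∈ A)] :
    (PMF.uniformOfFintype γ).toOuterMeasure A =
      ((univ.filter fun x => x ∈ A).card : ℝ≥0∞) / Fintype.card γ := by
  have h := uniform_map_toOuterMeasure_mem (Ω' := γ) id A
  rwa [PMF.map_id] at h

/-- **First law: the noise marginal of the product sample space is `G(n,1/2)`.** [folklore] -/
theorem fst_uniform_toOuterMeasure (n k : ℕ) (A : Set (EdgeVec n)) :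
    ((PMF.uniformOfFintype (EdgeVec n × kSubsets n k)).map fun p => p.1).toOuterMeasure A =
      (erdosRenyiHalf n).toOuterMeasure A := by
  classical
  rw [uniform_map_toOuterMeasure_mem, erdosRenyiHalf, uniform_toOuterMeasure_eq, Fintype.card_prod]
  have hprod : (univ.filter fun p : EdgeVec n × kSubsets n k => p.1 ∈ A) =
      (univ.filter fun x : EdgeVec n => x ∈ A) ×ˢ (univ : Finset (kSubsets n k)) := by
    ext p
    simp
  rw [hprod, card_product, card_univ]
  push_cast
  exact ENNReal.mul_div_mul_right _ _ (by exact_mod_cast Fintype.card_ne_zero)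
    (ENNReal.natCast_ne_top _)

/-- **Second law: planting the clique of the independent uniform `k`-set gives `plantedCliqueDist`.**
[folklore] -/
theorem plant_uniform_toOuterMeasure (n k : ℕ) (A : Set (EdgeVec n)) :
    ((PMF.uniformOfFintype (EdgeVec n × kSubsets n k)).map fun p =>
        fun (e : (⊤ : SimpleGraph (Fin n)).edgeSet) =>
          p.1 e || decide (∀ v ∈ (e : Sym2 (Fin n)), v ∈ (p.2 : Finset (Fin n)))).toOuterMeasure A =
      (plantedCliqueDist n k).toOuterMeasure A := by
  classical
  set K := kSubsets n k with hK
  set u := PMF.uniformOfFinset K (kSubsets_nonempty n k) with hu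
  -- the planted-clique law, fibred over the planted set
  have hP1 : (plantedCliqueDist n k).toOuterMeasure A =
      ∑' S, u S * (erdosRenyiHalf n).toOuterMeasure {x | plant S x ∈ A} := by
    rw [plantedCliqueDist, PMF.toOuterMeasure_map_apply, plantedCliqueJoint,
      PMF.toOuterMeasure_bind_apply]
    refine tsum_congr fun S => ?_
    rw [PMF.toOuterMeasure_map_apply]
    rfl
  have hfib : ∀ S, (erdosRenyiHalf n).toOuterMeasure {x | plant S x ∈ A} =
      ((univ.filter fun x : EdgeVec n => plant S x ∈ A).card : ℝ≥0∞) / Fintype.card (EdgeVec n) := by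
    intro S
    rw [erdosRenyiHalf, uniform_toOuterMeasure_eq]
    rfl
  have hP2 : (plantedCliqueDist n k).toOuterMeasure A =
      ∑ S ∈ K, (K.card : ℝ≥0∞)⁻¹ *
        (((univ.filter fun x : EdgeVec n => plant S x ∈ A).card : ℝ≥0∞) / Fintype.card (EdgeVec n)) := by
    rw [hP1, tsum_eq_sum (s := K)]
    · refine Finset.sum_congr rfl fun S hS => ?_
      rw [hfib, hu, PMF.uniformOfFinset_apply_of_mem (kSubsets_nonempty n k) hS]
    · intro S hS
      rw [hu, PMF.uniformOfFinset_apply_of_notMem (kSubsets_nonempty n k) hS, zero_mul]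
  -- the product-space side, counted fibrewise over the planted set
  rw [uniform_map_toOuterMeasure_mem, Fintype.card_prod, Fintype.card_coe, hP2]
  have hcount : ((univ.filter fun p : EdgeVec n × K =>
      (fun (e : (⊤ : SimpleGraph (Fin n)).edgeSet) => p.1 e ||
        decide (∀ v ∈ (e : Sym2 (Fin n)), v ∈ (p.2 : Finset (Fin n)))) ∈ A).card : ℝ≥0∞) =
      ∑ S ∈ K, ((univ.filter fun x : EdgeVec n => plant S x ∈ A).card : ℝ≥0∞) := by
    rw [Finset.card_filter, Fintype.sum_prod_type_right]
    rw [← Finset.sum_coe_sort K]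
    push_cast
    refine Finset.sum_congr rfl fun S _ => ?_
    rw [Finset.card_filter]
    push_cast
    rfl
  rw [hcount, div_eq_mul_inv, Finset.sum_mul]
  refine Finset.sum_congr rfl fun S _ => ?_
  have hU0 : (Fintype.card (EdgeVec n) : ℝ≥0∞) ≠ 0 := by exact_mod_cast Fintype.card_ne_zero
  rw [div_eq_mul_inv, Nat.cast_mul, ENNReal.mul_inv (Or.inl hU0) (Or.inl (ENNReal.natCast_ne_top _))]
  ring

/-- The size slack of the OR-channel form (`+ |E(Kₙ)|`) is absorbed by doubling the exponent.
[folklore] -/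
theorem pow_card_edgeSet_le (n s a : ℕ) [Fintype ((⊤ : SimpleGraph (Fin n)).edgeSet)] :
    (s + Fintype.card ((⊤ : SimpleGraph (Fin n)).edgeSet)) ^ a ≤ (s + n) ^ (2 * a) := by
  classical
  have hE : Fintype.card ((⊤ : SimpleGraph (Fin n)).edgeSet) ≤ n * n := by
    calc Fintype.card ((⊤ : SimpleGraph (Fin n)).edgeSet)
        = ((⊤ : SimpleGraph (Fin n)).edgeFinset).card := SimpleGraph.card_edgeSet
      _ ≤ (Fintype.card (Fin n)).choose 2 := SimpleGraph.card_edgeFinset_le_card_choose_two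
      _ = n * (n - 1) / 2 := by rw [Fintype.card_fin, Nat.choose_two_right]
      _ ≤ n * (n - 1) := Nat.div_le_self _ _
      _ ≤ n * n := Nat.mul_le_mul_left n (Nat.sub_le n 1)
  have h2 : s + n * n ≤ (s + n) ^ 2 := by nlinarith [Nat.le_mul_self s]
  calc (s + Fintype.card ((⊤ : SimpleGraph (Fin n)).edgeSet)) ^ a ≤ (s + n * n) ^ a :=
        Nat.pow_le_pow_left (Nat.add_le_add_left hE s) a
    _ ≤ ((s + n) ^ 2) ^ a := Nat.pow_le_pow_left h2 a
    _ = (s + n) ^ (2 * a) := by rw [← pow_mul]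

/-- For `n ≥ 3`, `n ≤ |E(Kₙ)| = C(n,2)`: the crux's slack `+ n` is below the OR-channel slack. [folklore] -/
theorem le_card_edgeSet (n : ℕ) (hn : 3 ≤ n) :
    n ≤ Fintype.card ((⊤ : SimpleGraph (Fin n)).edgeSet) := by
  classical
  rw [SimpleGraph.card_edgeSet, SimpleGraph.card_edgeFinset_top_eq_card_choose_two, Fintype.card_fin,
    Nat.choose_two_right, Nat.le_div_iff_mul_le (by norm_num)]
  have h : n * 2 ≤ n * (n - 1) := Nat.mul_le_mul_left n (by omega)
  simpa [mul_comm] using h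

/-- **The crux is the clique instance of the OR-channel schema.** For every `δ`, the body of
`Summit.PneNP.PneNP.Theses.KarlinRubin.MonotoneSuffices` at `δ` is EQUIVALENT to the OR-channel
statement (`∃ a ∀ s`, hypothesis/conclusion over the laws of `X u` and `X u ∨ P s` for `(u, s)` uniform on
`U n × S n`, size slack `+ |ι n|`) instantiated at `ι n = E(Kₙ)`, `U n = EdgeVec n`, `S n = kSubsets n
⌈n^{1/2-δ}⌉`, `X = id`, `P S =` the clique on `S` — the two laws ARE `erdosRenyiHalf n` and
`plantedCliqueDist n ⌈n^{1/2-δ}⌉` (`fst_uniform_toOuterMeasure`, `plant_uniform_toOuterMeasure`), and the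
slacks `+ n` / `+ C(n,2)` are interchangeable under `∃ a` (`pow_card_edgeSet_le`, `le_card_edgeSet`). The
schema's universal closure (all `ι, U, S, X, P`) is what `monotoneSuffices_false_without_productNoise`
refutes (block-parity instance); this equivalence certifies that the crux is another instance of the SAME
schema, i.e. that the refutation removes exactly the product-noise/clique specifics. [folklore] -/
theorem monotoneSufficesAt_iff_orChannel_cliqueInstance (δ : ℝ) :
    (∃ a : ℕ, ∀ s : ℕ → ℕ,
      (∃ C : (n : ℕ) → Circuit ((⊤ : SimpleGraph (Fin n)).edgeSet),
        (∀ᶠ n : ℕ in atTop, (C n).IsOver B2 ∧ (C n).size ≤ s n) ∧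
        Tendsto (fun n : ℕ => (erdosRenyiHalf n).toOuterMeasure {x | (C n).eval x = true} +
          (plantedCliqueDist n ⌈(n : ℝ) ^ (1 / 2 - δ)⌉₊).toOuterMeasure {x | (C n).eval x = false})
          atTop (𝓝 0)) →
      ∃ C' : (n : ℕ) → Circuit ((⊤ : SimpleGraph (Fin n)).edgeSet),
        (∀ᶠ n : ℕ in atTop, (C' n).IsOver monotoneBasis01 ∧ (C' n).size ≤ (s n + n) ^ a) ∧
        Tendsto (fun n : ℕ => (erdosRenyiHalf n).toOuterMeasure {x | (C' n).eval x = true} +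
          (plantedCliqueDist n ⌈(n : ℝ) ^ (1 / 2 - δ)⌉₊).toOuterMeasure {x | (C' n).eval x = false})
          atTop (𝓝 0)) ↔
    (∃ a : ℕ, ∀ s : ℕ → ℕ,
      (∃ C : (n : ℕ) → Circuit ((⊤ : SimpleGraph (Fin n)).edgeSet),
        (∀ᶠ n : ℕ in atTop, (C n).IsOver B2 ∧ (C n).size ≤ s n) ∧
        Tendsto (fun n : ℕ =>
          ((PMF.uniformOfFintype (EdgeVec n × kSubsets n ⌈(n : ℝ) ^ (1 / 2 - δ)⌉₊)).map
              fun p => p.1).toOuterMeasure {x | (C n).eval x = true} +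
            ((PMF.uniformOfFintype (EdgeVec n × kSubsets n ⌈(n : ℝ) ^ (1 / 2 - δ)⌉₊)).map
              fun p => fun (e : (⊤ : SimpleGraph (Fin n)).edgeSet) =>
                p.1 e || decide (∀ v ∈ (e : Sym2 (Fin n)), v ∈ (p.2 : Finset (Fin n)))).toOuterMeasure
              {x | (C n).eval x = false}) atTop (𝓝 0)) →
      ∃ C' : (n : ℕ) → Circuit ((⊤ : SimpleGraph (Fin n)).edgeSet),
        (∀ᶠ n : ℕ in atTop, (C' n).IsOver monotoneBasis01 ∧
          (C' n).size ≤ (s n + Fintype.card ((⊤ : SimpleGraph (Fin n)).edgeSet)) ^ a) ∧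
        Tendsto (fun n : ℕ =>
          ((PMF.uniformOfFintype (EdgeVec n × kSubsets n ⌈(n : ℝ) ^ (1 / 2 - δ)⌉₊)).map
              fun p => p.1).toOuterMeasure {x | (C' n).eval x = true} +
            ((PMF.uniformOfFintype (EdgeVec n × kSubsets n ⌈(n : ℝ) ^ (1 / 2 - δ)⌉₊)).map
              fun p => fun (e : (⊤ : SimpleGraph (Fin n)).edgeSet) =>
                p.1 e || decide (∀ v ∈ (e : Sym2 (Fin n)), v ∈ (p.2 : Finset (Fin n)))).toOuterMeasure
              {x | (C' n).eval x = false}) atTop (𝓝 0)) := by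
  set k : ℕ → ℕ := fun n => ⌈(n : ℝ) ^ (1 / 2 - δ)⌉₊ with hk
  -- the two error functionals coincide termwise
  have heq : ∀ D : (n : ℕ) → Circuit ((⊤ : SimpleGraph (Fin n)).edgeSet),
      (fun n : ℕ =>
        ((PMF.uniformOfFintype (EdgeVec n × kSubsets n (k n))).map fun p => p.1).toOuterMeasure
            {x | (D n).eval x = true} +
          ((PMF.uniformOfFintype (EdgeVec n × kSubsets n (k n))).map
            fun p => fun (e : (⊤ : SimpleGraph (Fin n)).edgeSet) =>
              p.1 e || decide (∀ v ∈ (e : Sym2 (Fin n)), v ∈ (p.2 : Finset (Fin n)))).toOuterMeasure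
            {x | (D n).eval x = false}) =
      fun n : ℕ => (erdosRenyiHalf n).toOuterMeasure {x | (D n).eval x = true} +
        (plantedCliqueDist n (k n)).toOuterMeasure {x | (D n).eval x = false} := by
    intro D
    funext n
    rw [fst_uniform_toOuterMeasure, plant_uniform_toOuterMeasure]
  constructor
  · rintro ⟨a, ha⟩
    refine ⟨a, fun s hyp => ?_⟩
    obtain ⟨C, hC, hT⟩ := hyp
    rw [heq C] at hT
    obtain ⟨C', hC', hT'⟩ := ha s ⟨C, hC, hT⟩
    refine ⟨C', ?_, by rw [heq C']; exact hT'⟩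
    filter_upwards [hC', eventually_ge_atTop 3] with n hn h3
    exact ⟨hn.1, hn.2.trans (Nat.pow_le_pow_left (Nat.add_le_add_left (le_card_edgeSet n h3) _) a)⟩
  · rintro ⟨a, ha⟩
    refine ⟨2 * a, fun s hyp => ?_⟩
    obtain ⟨C, hC, hT⟩ := hyp
    obtain ⟨C', hC', hT'⟩ := ha s ⟨C, hC, by rw [heq C]; exact hT⟩
    refine ⟨C', ?_, by rw [← heq C']; exact hT'⟩
    filter_upwards [hC'] with n hn
    exact ⟨hn.1, hn.2.trans (pow_card_edgeSet_le n (s n) a)⟩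

end Summit.PneNP.PneNP.Theorems.MonotoneSuffices.Negative
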